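import Literature.NumberTheory.EllipticCurves.CastellaGrossiSkinner2025.PerrinRiouMainConjecture
import Literature.NumberTheory.EllipticCurves.Wuthrich2014.ReducibleDivisibility
import Literature.NumberTheory.EllipticCurves.CyclotomicIwasawaMainTheoremIrreducibleAuxiliaryFieldsProofs
import Literature.NumberTheory.EllipticCurves.NonvanishingTwistsProofs
import Literature.NumberTheory.EllipticCurves.Rank1Residual.GVParityTwistProofs
import Literature.NumberTheory.EllipticCurves.PAdicLFunctionNeZeroHoldsProofs
import Literature.NumberTheory.EllipticCurves.SelmerInftyTorsionFiniteProofs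
import Literature.NumberTheory.EllipticCurves.BSDSelmerCMPConverseHeegnerDescentProofs
import Literature.NumberTheory.EllipticCurves.IwasawaSelmerIsTorsionProofs
import Literature.NumberTheory.EllipticCurves.ZpExtensionProofs
import Literature.NumberTheory.EllipticCurves.CyclotomicZpExtension
import Literature.NumberTheory.EllipticCurves.PAdicGrossZagierConstantTermProofs
import Literature.NumberTheory.EllipticCurves.LeadingTermPPartProofs
import Literature.NumberTheory.GaloisRepresentations.LocalKroneckerWeberInertiaProofs
import HarnessLib

/-!
# Castella–Grossi–Skinner 2025, §7.2 "Proof of Theorem A" in the kernel: Theorem 7.2.3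
# (+ Prop. 3.3.1, Wuthrich 2014 Thm. 16, Rohrlich) ⇒ Theorem A, and conversely
# Theorem A (for `E` and `E^K`) + Prop. 3.3.1 ⇒ Theorem 7.2.3

`Proofs` companion (THEOREMS ONLY: no definition, no named fact, no `sorry`) of
`Literature.NumberTheory.EllipticCurves.CastellaGrossiSkinner2025.PerrinRiouMainConjecture`, which
vendors the two named facts `thm723_charIdeal_eq_padicLFunction_mul` (printed Thm. 7.2.3, read
through Prop. 2.2.4) and `prop331_nonempty_linearEquiv_prod` (printed Prop. 3.3.1, first display).
HONEST FRAMING (cell `bsd-littype`, seat `bsd-littype-02` gen 2): typed ≠ proved ≠ endorsed; nothing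
here proves BSD; these are kernel EDGES between named print nodes of the D4 by-name chain.

## What is proved (source: final TeX of Math. Ann. 393 (2025) = arXiv:2303.04373v2, l. 3450–3462,
"Proof of Theorem A"; store v1 `[corpus: paper:arxiv-2303.04373 p0028:L76–L91]`)

> Choose an imaginary quadratic field `K` satisfying hypotheses (disc), (Heeg), and (spl). As
> before, from [Kato] and [Wuthrich] we have the divisibilities `ch_{Λ_ℚ}(𝔛_ord(E/ℚ_∞)) ⊇
> (𝓛_p^MSD(E/ℚ))`, `ch_{Λ_ℚ}(𝔛_ord(E^K/ℚ_∞)) ⊇ (𝓛_p^MSD(E^K/ℚ))` in `Λ_ℚ`. If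
> `ch_{Λ_ℚ}(𝔛_ord(E/ℚ_∞)) ≠ (𝓛_p^MSD(E/ℚ))` then from Proposition 2.2.4 and Proposition 3.3.1 we
> conclude that `(𝓛_p^PR(E/K)⁺) ⊊ ch_{Λ_K⁺}(𝔛_ord(E/K_∞⁺))`, but this contradicts Theorem 7.2.3. Thus
> `ch_{Λ_ℚ}(𝔛_ord(E/ℚ_∞)) = (𝓛_p^MSD(E/ℚ))`, concluding the proof.

* `thmA_of_thm723` — exactly this paragraph: from the two named facts of the sibling, Wuthrich 2014
  Thm. 16 (`Wuthrich2014.charIdeal_dvd_padicLFunction`, the integral Kato divisibility at a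
  reducible prime, applied to `E` and to the twist `E^K`, which is again Eisenstein and good ordinary
  at `p`: `not_hasIrreducibleModPGaloisRep_twist`, `isOrdinaryAt_of_smul_eq_quadraticTwist`),
  Rohrlich's non-vanishing of `L_p` (tree theorem `padicLFunction_unitRoot_ne_zero`, needed to cancel
  — the word "⊊" of the proof) and modularity with Manin-constant data
  (`nonempty_modularParametrizationData`, to attach a newform and a period ratio `ϖ'` to `E^K`), the
  conclusion of Theorem A (`thmA_charIdeal_eq_padicLFunction`, A142) follows. The choice "Choose an
  imaginary quadratic field `K` satisfying (disc), (Heeg), (spl)" is the tree's Dirichlet-theorem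
  construction `exists_auxiliaryImaginaryQuadraticDiscr` + `exists_heegnerField_iff_exists_fundamental`;
  the cyclotomic `ℤ_p`-extension of `K` with a normalised generator is constructed here
  (`exists_normalisedCyclotomicPair_of_finrank_eq_two`, re-homing the quadratic squaring trick of
  `Summits/…/Additive/CyclotomicZpExtensionQuadratic.lean`, which Literature cannot import).
* `thm723_of_thmA` — the converse bookkeeping: Theorem A for `E` and for `E^K` (both satisfy its
  hypotheses: `a_p(E^K) = (d_K/p)·a_p(E) = a_p(E)` as `p` splits, `frobeniusTrace_quadraticTwist_holds`)
  and Prop. 3.3.1 give Thm. 7.2.3 as typed. Hence, relative to A142, the sibling's new trust debt is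
  Prop. 3.3.1 alone.
* `charIdeal_eq_mul_of_prop331` — the printed "In particular" of Prop. 3.3.1 (product of
  characteristic ideals), derived from the first display for torsion summands (the tree's
  `Module.charIdeal` is meaningful for finitely generated torsion modules; finiteness is the tree
  theorem `SelmerDualData.module_finite_of_isCyclotomic`).
* Pure algebra used for "⊊ … contradicts": `eq_span_singleton_of_mul_eq_span_mul` (private) — in a domain,
  `a ∈ I`, `b ∈ J`, `b ≠ 0`, `I·J = (ab)` force `I = (a)`.

## References
* [CastellaGrossiSkinner2025] Math. Ann. 393 (2025) 2451–2506 = arXiv:2303.04373v2, §7.2 "Proof of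
  Theorem A" (l. 3450–3462), Thm. 7.2.3, Prop. 3.3.1, Prop. 2.2.4.
* [Wuthrich2014] Doc. Math. 19 (2014), Thm. 16 (tree fact `Wuthrich2014.charIdeal_dvd_padicLFunction`).
* [RohrlichInventiones1984] D. Rohrlich, Invent. Math. 75 (1984) (tree theorem
  `padicLFunction_unitRoot_ne_zero`).
* [Washington1997] §13.1 (cyclotomic `ℤ_p`-extension of a number field).
-/

noncomputable section

open scoped Classical MatrixGroups ModularForm

open CongruenceSubgroup WeierstrassCurve NumberField Field Literature.NumberTheory.EllipticCurves
  Literature.NumberTheory.EllipticCurves.ModularForms Literature.NumberTheory.EllipticCurves.Rank1Residual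
  Literature.NumberTheory.GaloisRepresentations Literature.NumberTheory.EllipticCurves.CyclotomicZp

namespace Literature.NumberTheory.EllipticCurves.CastellaGrossiSkinner2025

/-! ### 1. Pure algebra -/

/-- In a commutative domain: if `a ∈ I`, `b ∈ J`, `b ≠ 0` and `I · J = (a b)`, then `I = (a)`
(for `x ∈ I`, `x b ∈ (ab)` gives `x = y a`). This is the sentence "a proper divisibility … would
contradict [the equality over `K`]" of the printed proof of Theorem A. [folklore] -/
private theorem eq_span_singleton_of_mul_eq_span_mul {R : Type*} [CommRing R] [IsDomain R]
    {I J : Ideal R} {a b : R} (ha : a ∈ I) (hb : b ∈ J) (hb0 : b ≠ 0)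
    (h : I * J = Ideal.span {a * b}) : I = Ideal.span {a} := by
  refine le_antisymm (fun x hx ↦ ?_) ((Ideal.span_singleton_le_iff_mem _).mpr ha)
  have hxb : x * b ∈ Ideal.span {a * b} := h ▸ Ideal.mul_mem_mul hx hb
  obtain ⟨y, hy⟩ := Ideal.mem_span_singleton'.mp hxb
  have hx' : x = y * a := by
    have : (x - y * a) * b = 0 := by rw [sub_mul, mul_assoc, hy, sub_self]
    rcases mul_eq_zero.mp this with h0 | h0
    · exact sub_eq_zero.mp h0
    · exact absurd h0 hb0
  exact hx' ▸ Ideal.mul_mem_left _ _ (Ideal.mem_span_singleton_self a)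

/-- Torsion is invariant under linear equivalences. [folklore] -/
private theorem isTorsion_of_linearEquiv {R : Type*} [CommRing R] {M N : Type*} [AddCommGroup M]
    [Module R M] [AddCommGroup N] [Module R N] (e : M ≃ₗ[R] N) (h : Module.IsTorsion R N) :
    Module.IsTorsion R M := by
  intro x
  obtain ⟨a, ha⟩ := @h (e x)
  refine ⟨a, e.injective ?_⟩
  change e ((a : R) • x) = e 0
  rw [map_smul, map_zero]
  exact ha

/-! ### 2. The cyclotomic `ℤ_p`-extension of a quadratic field with a normalised generator
(Washington §13.1; re-homed verbatim from `Summits/BirchSwinnertonDyer/Rank1Residual/Additive/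
CyclotomicZpExtensionQuadratic.lean`, seat additive-p4, which a Literature file cannot import) -/

section Quadratic

variable (L : Type) [Field L] [NumberField L] (p : ℕ) [Fact p.Prime]

/-- `γ_cyc^a · γ_cyc^b = γ_cyc^{a+b}` as units of `ℤ_p`. [folklore] -/
private theorem cycPowUnit_mul_cycPowUnit (a b : ℤ_[p]) :
    cycPowUnit p a * cycPowUnit p b = cycPowUnit p (a + b) := by
  ext
  rw [Units.val_mul, val_cycPowUnit, val_cycPowUnit, val_cycPowUnit, ← AddChar.map_add_eq_mul]

/-- The square of any `g ∈ Γ_ℚ` is a restriction from `Γ_L` when `[L : ℚ] = 2` (the image of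
`Γ_L → Γ_ℚ` has index `≤ 2`, tree `inv_mul_mem_range_absGaloisRestrict`). [folklore] -/
private theorem sq_mem_range_absGaloisRestrict_of_finrank_eq_two (h2 : Module.finrank ℚ L = 2)
    (g : absoluteGaloisGroup ℚ) : g ^ 2 ∈ Set.range (absGaloisRestrict ℚ L) := by
  by_cases hg : g ∈ Set.range (absGaloisRestrict ℚ L)
  · obtain ⟨x, rfl⟩ := hg
    exact ⟨x ^ 2, map_pow _ _ _⟩
  · have hg' : g⁻¹ ∉ Set.range (absGaloisRestrict ℚ L) := by
      rintro ⟨x, hx⟩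
      exact hg ⟨x⁻¹, by rw [map_inv, hx, inv_inv]⟩
    have h := inv_mul_mem_range_absGaloisRestrict h2 hg' hg
    rwa [inv_inv, ← pow_two] at h

/-- `χ_p(Γ_L) ⊇ γ_cyc^{ℤ_p}` for a quadratic field `L` and odd `p` (squaring trick: `x = w + w`,
`χ_p(g) = γ_cyc^w` over `ℚ`, `g² = res σ`). [cite: Washington1997, §13.1] -/
theorem exists_cyclotomicCharacter_eq_cycPowUnit (h2 : Module.finrank ℚ L = 2) (hp : p ≠ 2)
    (x : ℤ_[p]) :
    ∃ σ : absoluteGaloisGroup L, GaloisRep.cyclotomicCharacter L p σ = cycPowUnit p x := by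
  obtain ⟨w, hw⟩ : ∃ w : ℤ_[p], w + w = x := by
    have h2u : IsUnit (2 : ℤ_[p]) := by
      rw [PadicInt.isUnit_iff]
      refine le_antisymm (PadicInt.norm_le_one _) (not_lt.mp fun hlt ↦ hp ?_)
      have h2 : ((2 : ℤ) : ℤ_[p]) = 2 := by norm_cast
      rw [← h2, PadicInt.norm_int_lt_one_iff_dvd] at hlt
      have hdvd : p ∣ 2 := by exact_mod_cast hlt
      exact (Nat.prime_dvd_prime_iff_eq (Fact.out : p.Prime) Nat.prime_two).mp hdvd
    refine ⟨(h2u.unit⁻¹ : ℤ_[p]ˣ) * x, ?_⟩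
    rw [← two_mul, ← mul_assoc, IsUnit.mul_val_inv, one_mul]
  obtain ⟨g, hg⟩ := GaloisRep.cyclotomicCharacter_rat_surjective p (cycPowUnit p w)
  obtain ⟨σ, hσ⟩ := sq_mem_range_absGaloisRestrict_of_finrank_eq_two L h2 g
  refine ⟨σ, ?_⟩
  haveI : NeZero (p : ℚ) := ⟨by exact_mod_cast (Fact.out : p.Prime).ne_zero⟩
  rw [← cyclotomicCharacter_absGaloisRestrict ℚ L p σ, hσ, map_pow, hg, pow_two,
    cycPowUnit_mul_cycPowUnit, hw]

/-- **The cyclotomic `ℤ_p`-extension of a quadratic field with a NORMALISED topological generator**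
(`[L : ℚ] = 2`, `p` odd): a cyclotomic `κ : ZpExtension L p` (`κ = ℓ ∘ χ_p|Γ_L`) and `γ ∈ Γ_L` with
`κ γ = 1` and `χ_p(γ) · ζ = γ_cyc` (here `ζ = 1`) — the inline hypothesis of the sibling's two facts.
[cite: Washington1997, §13.1] -/
theorem exists_normalisedCyclotomicPair_of_finrank_eq_two (h2 : Module.finrank ℚ L = 2)
    (hp : p ≠ 2) :
    ∃ κ : ZpExtension L p, κ.IsCyclotomic ∧ ∃ γ : absoluteGaloisGroup L, κ.IsTopGenerator γ ∧
      ∃ ζ : ℤ_[p]ˣ, IsOfFinOrder ζ ∧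
        ((GaloisRep.cyclotomicCharacter L p γ * ζ : ℤ_[p]ˣ) : ℤ_[p]) =
          (cyclotomicGenerator p : ℤ_[p]) := by
  let κ : ZpExtension L p :=
    { toContinuousMonoidHom := (ellHom p).comp (GaloisRep.cyclotomicCharacter L p)
      surjective := by
        intro y
        obtain ⟨σ, hσ⟩ := exists_cyclotomicCharacter_eq_cycPowUnit L p h2 hp y.toAdd
        refine ⟨σ, ?_⟩
        change ellHom p (GaloisRep.cyclotomicCharacter L p σ) = y
        rw [hσ, ellHom_apply, ell_cycPowUnit, ofAdd_toAdd] }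
  have hκ : ∀ σ, κ σ = Multiplicative.ofAdd (ell p (GaloisRep.cyclotomicCharacter L p σ)) :=
    fun _ ↦ rfl
  refine ⟨κ, ?_, ?_⟩
  · ext σ
    rw [ZpExtension.mem_kerSubgroup, Subgroup.mem_comap, CommGroup.mem_torsion, hκ, ofAdd_eq_one,
      ell_eq_zero_iff]
    rfl
  · obtain ⟨γ, hγ⟩ := exists_cyclotomicCharacter_eq_cycPowUnit L p h2 hp 1
    refine ⟨γ, ?_, 1, IsOfFinOrder.one, ?_⟩
    · rw [ZpExtension.IsTopGenerator, hκ, hγ, ell_cycPowUnit]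
    · rw [mul_one, hγ, val_cycPowUnit, cycPow_one]

end Quadratic

/-! ### 3. The auxiliary field `K` of §7.2 ("Choose an imaginary quadratic field `K` satisfying
hypotheses (Heeg), (spl), and (disc)") and the bookkeeping on the twist `E^K` -/

/-- **Existence of the auxiliary field**: for `N ≠ 0` and a prime `p` there is an imaginary
quadratic `K` with (Heeg) for `N`, (spl) at `p`, and (disc) `d_K` odd, `d_K ≠ −3` (Dirichlet's
theorem: `d_K = −q`, `q ≡ −1 (mod 8pN)` prime; tree `exists_auxiliaryImaginaryQuadraticDiscr` =
BCS25 Lemma 5.2.3, and the dictionary `exists_heegnerField_iff_exists_fundamental`).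
[cite: CastellaGrossiSkinner2025, §7.2 first paragraph (l. 3288)]
[cite: BurungaleCastellaSkinner2025, Lemma 5.2.3] -/
theorem exists_auxiliaryField (N : ℕ) (hN : N ≠ 0) (p : ℕ) (hp : p.Prime) :
    ∃ (K : Type) (_ : Field K) (_ : NumberField K), IsImaginaryQuadratic K ∧
      SatisfiesHeegnerHypothesis N K ∧ Odd (discr K) ∧ discr K ≠ -3 ∧
        ((Ideal.span {(p : ℤ)}).primesOver (𝓞 K)).ncard = 2 := by
  obtain ⟨d, -, hd0, hd4, hsq, hd3, hkr⟩ :=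
    exists_auxiliaryImaginaryQuadraticDiscr (N * p) (mul_ne_zero hN hp.ne_zero) ∅
  obtain ⟨K, _, _, hK, -, hH, hP⟩ :=
    (exists_heegnerField_iff_exists_fundamental (N * p) 0
      (fun D ↦ D % 4 = 1 ∧ D ≠ -3)).mpr
      ⟨d, hd0, Or.inl ⟨hd4, hsq, by omega⟩, by simp only [Int.natAbs_pos]; omega, hkr, hd4, hd3⟩
  refine ⟨K, inferInstance, inferInstance, hK, hH.of_dvd (dvd_mul_right N p), ?_, hP.2, ?_⟩
  · exact Int.odd_iff.mpr (by omega)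
  · exact hH.of_dvd (dvd_mul_left p N) p hp dvd_rfl

section Twist

variable {W W' : WeierstrassCurve ℚ} [W.IsElliptic] [W.IsGloballyMinimal] [W'.IsElliptic]
  [W'.IsGloballyMinimal] {p : ℕ} [Fact p.Prime] {K : Type} [Field K] [NumberField K]

/-- For `K` imaginary quadratic with `p` split: `d_K` is squarefree when odd, `p ∤ d_K`, and
`(d_K/p) = 1`. [folklore] -/
private theorem discr_squarefree_and_not_dvd_and_legendreSym (hK : IsImaginaryQuadratic K)
    (hodd : Odd (discr K)) (hsplit : ((Ideal.span {(p : ℤ)}).primesOver (𝓞 K)).ncard = 2) :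
    Squarefree (discr K) ∧ ¬ (p : ℤ) ∣ discr K ∧ legendreSym p (discr K) = 1 := by
  have hpP : p.Prime := Fact.out
  refine ⟨?_, ?_, ?_⟩
  · rcases QuadraticFields.Quadratic.isFundamentalDiscriminant_discr hK.1 with h | h
    · exact h.2.1
    · exfalso
      obtain ⟨k, hk⟩ := h.1
      exact (Int.odd_iff.mp hodd).symm.trans_ne (by omega) rfl
  · exact not_dvd_discr_of_ncard_primesOver hpP (hsplit.trans hK.1.symm)
  · obtain ⟨hsq, hne⟩ := isSquare_discr_of_ncard_primesOver_eq_two hK.1 hpP hsplit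
    exact (legendreSym.eq_one_iff p hne).mpr hsq

/-- **The twist `E^K` is again good ordinary, Eisenstein and non-anomalous at `p`** (for `p > 2`
split in `K`, `d_K` odd): `a_p(E^K) = (d_K/p)·a_p(E) = a_p(E)` (`frobeniusTrace_quadraticTwist_holds`),
`E^K[p] ≅ E[p] ⊗ ε_K` is reducible (`not_hasIrreducibleModPGaloisRep_twist`), good reduction at
`p ∤ 2d_K` (`isOrdinaryAt_of_smul_eq_quadraticTwist`) — the bookkeeping behind "Kato's divisibility
(as refined by Wuthrich) applied to `E_•` and `E_•^K`" (§1.2, final TeX l. 554–557, and §7.2).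
[cite: CastellaGrossiSkinner2025, §1.2 (l. 554–557) and §7.2 proof of Lemma 7.2.2 (E^K alongside E at the Eisenstein prime p)]
[cite: RubinSilverberg2002, §1 (a_p of a quadratic twist)] -/
theorem twist_hypotheses (hp : 2 < p) (hgood : Good W p) (hred : Red W p) (hna : ¬ Anom W p)
    (hK : IsImaginaryQuadratic K) (hodd : Odd (discr K))
    (hsplit : ((Ideal.span {(p : ℤ)}).primesOver (𝓞 K)).ncard = 2)
    (hW' : ∃ C : VariableChange ℚ, C • W' = W.quadraticTwist (discr K : ℚ)) :
    IsOrdinaryAt W' p ∧ Good W' p ∧ Red W' p ∧ ¬ Anom W' p ∧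
      W'.frobeniusTrace p = W.frobeniusTrace p := by
  have hpP : p.Prime := Fact.out
  have hp2 : p ≠ 2 := by omega
  obtain ⟨hsqf, hpd, hleg⟩ := discr_squarefree_and_not_dvd_and_legendreSym (p := p) hK hodd hsplit
  obtain ⟨C, hC⟩ := hW'
  have hd0 : (discr K : ℚ) ≠ 0 := by exact_mod_cast (IsImaginaryQuadratic.discr_neg hK).ne
  have hordW : IsOrdinaryAt W p := goodOrd_of_red_of_good W p hp hgood hred
  have hord' : IsOrdinaryAt W' p := isOrdinaryAt_of_smul_eq_quadraticTwist W W' hsqf hC p hp2 hpd hordW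
  have hred' : Red W' p := not_hasIrreducibleModPGaloisRep_twist hred hd0 W' C hC
  have hp2d : ¬ (p : ℤ) ∣ 2 * discr K := by
    intro h
    rcases (Nat.prime_iff_prime_int.mp hpP).dvd_or_dvd h with h2 | h2
    · exact hp2 ((Nat.prime_dvd_prime_iff_eq hpP Nat.prime_two).mp (by exact_mod_cast h2))
    · exact hpd h2
  have hap : W'.frobeniusTrace p = W.frobeniusTrace p := by
    rw [frobeniusTrace_quadraticTwist_holds W W' (discr K) hsqf ⟨C, hC⟩ p hp2d
      (W.not_dvd_minimalDiscriminantInt_of_hasGoodReductionAtPrime' p hgood), hleg, one_mul]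
  refine ⟨hord', hord'.1, hred', fun hA ↦ hna ⟨hred, hgood, ?_⟩, hap⟩
  rw [← hap]
  exact hA.2.2

end Twist

/-! ### 4. Prop. 3.3.1, "In particular": the product of characteristic ideals -/

/-- **Prop. 3.3.1, second display** ("In particular, `ch_{Λ_K⁺}(𝔛_ord(E/K_∞⁺)) =
ch_{Λ_ℚ}(𝔛_ord(E/ℚ_∞)) · ch_{Λ_ℚ}(𝔛_ord(E^K/ℚ_∞))`"), from the first display for torsion summands:
`𝔛_ord(E/K_∞⁺)` is then torsion and its characteristic ideal is the product (linear-equivalence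
invariance and multiplicativity of `char` over `⊕` for finitely generated torsion `Λ`-modules;
finite generation over `ℚ_∞` is the tree theorem `SelmerDualData.module_finite_of_isCyclotomic`).
[cite: CastellaGrossiSkinner2025, Prop. 3.3.1 (second display; arXiv v1 Prop. 2.2.1)] -/
theorem charIdeal_eq_mul_of_prop331 (h331 : prop331_nonempty_linearEquiv_prod)
    (W : WeierstrassCurve ℚ) [W.IsElliptic] [W.IsGloballyMinimal] (p : ℕ) [Fact p.Prime]
    (hp2 : p ≠ 2) (hord : IsOrdinaryAt W p) (K : Type) [Field K] [NumberField K]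
    (hK : IsImaginaryQuadratic K) (hH : SatisfiesHeegnerHypothesis (W.conductorNorm ℤ) K)
    (hsplit : ((Ideal.span {(p : ℤ)}).primesOver (𝓞 K)).ncard = 2)
    (W' : WeierstrassCurve ℚ) [W'.IsElliptic] [W'.IsGloballyMinimal]
    (hW' : ∃ C : VariableChange ℚ, C • W' = W.quadraticTwist (discr K : ℚ))
    (κK : ZpExtension K p) (γK : Field.absoluteGaloisGroup K) (κ : ZpExtension ℚ p)
    (γ : Field.absoluteGaloisGroup ℚ) (hκK : κK.IsCyclotomic) (hγK : κK.IsTopGenerator γK)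
    (hγK' : ∃ ζ : ℤ_[p]ˣ, IsOfFinOrder ζ ∧
      ((GaloisRep.cyclotomicCharacter K p γK * ζ : ℤ_[p]ˣ) : ℤ_[p]) = (cyclotomicGenerator p : ℤ_[p]))
    (hκ : κ.IsCyclotomic) (hγ : κ.IsTopGenerator γ) (hγ' : IsCyclotomicVariable p γ)
    (DK : (W.baseChange K).SelmerDualData κK γK) (D : W.SelmerDualData κ γ)
    (D' : W'.SelmerDualData κ γ) (hD : D.IsTorsion) (hD' : D'.IsTorsion) :
    DK.IsTorsion ∧ DK.charIdeal = D.charIdeal * D'.charIdeal := by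
  obtain ⟨e⟩ := h331 W p hp2 hord K hK hH hsplit W' hW' κK γK κ γ hκK hγK hγK' hκ hγ hγ' DK D D'
  haveI : Module.Finite (IwasawaAlgebra p) D.X := SelmerDualData.module_finite_of_isCyclotomic W κ hκ D hγ
  haveI : Module.Finite (IwasawaAlgebra p) D'.X :=
    SelmerDualData.module_finite_of_isCyclotomic W' κ hκ D' hγ
  refine ⟨isTorsion_of_linearEquiv e (BurungaleTian2019.isTorsion_prod hD hD'), ?_⟩
  unfold SelmerDualData.charIdeal
  rw [Module.charIdeal_eq_of_linearEquiv e, BurungaleTian2019.charIdeal_prod hD hD']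

/-! ### 5. Theorem A (for `E` and `E^K`) + Prop. 3.3.1 ⇒ Theorem 7.2.3 -/

/-- **Theorem A ⇒ Theorem 7.2.3 (as typed), given Prop. 3.3.1.** For `(E, p, K)` as in Thm. 7.2.3
the twist `E^K` again satisfies the hypotheses of Theorem A (`twist_hypotheses`); Theorem A for `E`
and `E^K` over the normalised cyclotomic pair of `ℚ` (`CyclotomicZp.zpExtension`) gives
`char 𝔛(E/ℚ_∞) = (g₁)`, `char 𝔛(E^K/ℚ_∞) = (g₂)` with `ι g₁ = ϖ L_p(f,α)`, `ι g₂ = ϖ' L_p(g,α')`, and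
Prop. 3.3.1 (`charIdeal_eq_mul_of_prop331`) gives `char 𝔛(E/K_∞⁺) = (g₁ g₂)`, torsion included.
So the sibling's Thm. 7.2.3 is DERIVED debt modulo Prop. 3.3.1 and A142.
[cite: CastellaGrossiSkinner2025, Thm. 7.2.3, Prop. 3.3.1, Prop. 2.2.4 and Thm. 7.1.1 = Theorem A] -/
theorem thm723_of_thmA (hA : thmA_charIdeal_eq_padicLFunction)
    (h331 : prop331_nonempty_linearEquiv_prod) : thm723_charIdeal_eq_padicLFunction_mul := by
  intro W _ _ p _ hp hgood hred hna K _ _ hK hH hodd h3 hsplit κK γK hκK hγK hγK' _ f hf ϖ hϖ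
    W' _ _ hW' _ g hg ϖ' hϖ' DK
  have hp2 : p ≠ 2 := by omega
  obtain ⟨hord', hgood', hred', hna', -⟩ := twist_hypotheses hp hgood hred hna hK hodd hsplit hW'
  -- the normalised cyclotomic pair over `ℚ` and the two dual data over `ℚ_∞`
  obtain ⟨γ, hγ, hχ⟩ := CyclotomicZp.exists_isTopGenerator_zpExtension p
  have hκ : (CyclotomicZp.zpExtension p).IsCyclotomic := CyclotomicZp.isCyclotomic_zpExtension p
  have hγ' : IsCyclotomicVariable p γ := ⟨1, IsOfFinOrder.one, by rw [mul_one]; exact hχ⟩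
  let D : W.SelmerDualData (CyclotomicZp.zpExtension p) γ := W.selmerDualData _ hγ
  let D' : W'.SelmerDualData (CyclotomicZp.zpExtension p) γ := W'.selmerDualData _ hγ
  obtain ⟨hDt, g₁, hg₁, hι₁⟩ := hA W p hp hgood hred hna _ γ hκ hγ hγ' f hf ϖ hϖ D
  obtain ⟨hD't, g₂, hg₂, hι₂⟩ := hA W' p hp hgood' hred' hna' _ γ hκ hγ hγ' g hg ϖ' hϖ' D'
  obtain ⟨hDKt, hchar⟩ := charIdeal_eq_mul_of_prop331 h331 W p hp2
    (goodOrd_of_red_of_good W p hp hgood hred) K hK hH hsplit W' hW' κK γK _ γ hκK hγK hγK' hκ hγ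
    hγ' DK D D' hDt hD't
  refine ⟨hDKt, g₁ * g₂, ?_, ?_⟩
  · rw [hchar, hg₁, hg₂, Ideal.span_singleton_mul_span_singleton]
  · rw [map_mul, hι₁, hι₂, Rat.cast_mul, map_mul]
    ring

/-! ### 6. Theorem 7.2.3 + Prop. 3.3.1 + Wuthrich 2014 Thm. 16 + Rohrlich ⇒ Theorem A
(the printed "Proof of Theorem A", l. 3450–3462) -/

/-- **Theorem 7.2.3 ⇒ Theorem A** — the printed proof of Theorem A (§7.2, l. 3450–3462) in the
kernel: given `(E, p)` as in Theorem A, CHOOSE `K` with (Heeg), (spl), (disc) (`exists_auxiliaryField`),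
its cyclotomic `ℤ_p`-extension with a normalised generator (`exists_normalisedCyclotomicPair_…`), a
minimal model `W'` of `E^K` with its newform `g` and period ratio `ϖ'` (modularity with Manin data,
`hmod`); Wuthrich's integral Kato divisibilities `ϖ L_p(f,α) = ι g₁`, `g₁ ∈ char 𝔛(E/ℚ_∞)` and
`ϖ' L_p(g,α') = ι g₂`, `g₂ ∈ char 𝔛(E^K/ℚ_∞)` (`hW16` twice; `E^K` is Eisenstein and good ordinary at
`p`), Prop. 3.3.1 `char 𝔛(E/K_∞⁺) = char 𝔛(E/ℚ_∞) · char 𝔛(E^K/ℚ_∞)` and Thm. 7.2.3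
`char 𝔛(E/K_∞⁺) = (G)`, `ι G = ϖϖ' L_p(f,α) L_p(g,α')` give `(G) = (g₁ g₂)`; since `g₂ ≠ 0`
(Rohrlich: `L_p(g,α') ≠ 0`; `ϖ' ≠ 0`), a proper inclusion `(g₁) ⊊ char 𝔛(E/ℚ_∞)` is impossible:
`char 𝔛(E/ℚ_∞) = (g₁)` (`eq_span_singleton_of_mul_eq_span_mul`). With torsion from `hW16` this
is the conclusion of `thmA_charIdeal_eq_padicLFunction`.
[cite: CastellaGrossiSkinner2025, §7.2 "Proof of Theorem A" (l. 3450–3462; arXiv v1 p. 28) from Thm. 7.2.3, Prop. 3.3.1, Prop. 2.2.4]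
[cite: Wuthrich2014, Thm. 16 (p. 397)] [cite: RohrlichInventiones1984, Theorem (p. 409)] -/
theorem thmA_of_thm723 (h723 : thm723_charIdeal_eq_padicLFunction_mul)
    (h331 : prop331_nonempty_linearEquiv_prod)
    (hW16 : Wuthrich2014.charIdeal_dvd_padicLFunction)
    (hmod : nonempty_modularParametrizationData) : thmA_charIdeal_eq_padicLFunction := by
  intro W _ _ p _ hp hgood hred hna κ γ hκ hγ hγ' _ f hf ϖ hϖ D
  have hpP : p.Prime := Fact.out
  have hp2 : p ≠ 2 := by omega
  have hordW : IsOrdinaryAt W p := goodOrd_of_red_of_good W p hp hgood hred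
  -- Step 0: the auxiliary field `K` and its cyclotomic `ℤ_p`-extension
  obtain ⟨K, _, _, hK, hH, hodd, h3, hsplit⟩ :=
    exists_auxiliaryField (W.conductorNorm ℤ) (NeZero.ne _) p hpP
  obtain ⟨κK, hκK, γK, hγK, hγK'⟩ := exists_normalisedCyclotomicPair_of_finrank_eq_two K p hK.1 hp2
  -- the twist `E^K`: a minimal model, its newform and period ratio
  have hd0 : (discr K : ℚ) ≠ 0 := by exact_mod_cast (IsImaginaryQuadratic.discr_neg hK).ne
  obtain ⟨W', hE', hM', C, hC⟩ := exists_isGloballyMinimal_smul_eq_quadraticTwist W hd0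
  have hW' : ∃ C : VariableChange ℚ, C • W' = W.quadraticTwist (discr K : ℚ) := ⟨C, hC⟩
  obtain ⟨hord', -, hred', -, -⟩ := twist_hypotheses hp hgood hred hna hK hodd hsplit hW'
  haveI : NeZero (W'.conductorNorm ℤ) := ⟨(W'.conductorNorm_pos_holds).ne'⟩
  obtain ⟨M'⟩ := hmod W'
  obtain ⟨ϖ', hϖ'0, hϖ', -⟩ := M'.exists_rat_mul_realPeriodRat_eq_plusPeriod
  -- the dual data over `K_∞⁺` and over `ℚ_∞` for the twist
  let DK : (W.baseChange K).SelmerDualData κK γK := (W.baseChange K).selmerDualData κK hγK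
  let D' : W'.SelmerDualData κ γ := W'.selmerDualData κ hγ
  -- Theorem 7.2.3 over `K`, Wuthrich's divisibilities over `ℚ`, Prop. 3.3.1
  obtain ⟨-, G, hG, hιG⟩ := h723 W p hp hgood hred hna K hK hH hodd h3 hsplit κK γK hκK hγK hγK'
    f hf ϖ hϖ W' hW' M'.f M'.isNewformOf ϖ' hϖ' DK
  obtain ⟨hDt, g₁, hg₁, hι₁⟩ := hW16 W p hp2 hordW hred hκ hγ hγ' hf D ϖ hϖ
  obtain ⟨hD't, g₂, hg₂, hι₂⟩ := hW16 W' p hp2 hord' hred' hκ hγ hγ' M'.isNewformOf D' ϖ' hϖ'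
  obtain ⟨-, hchar⟩ := charIdeal_eq_mul_of_prop331 h331 W p hp2 hordW K hK hH hsplit W' hW' κK γK κ
    γ hκK hγK hγK' hκ hγ hγ' DK D D' hDt hD't
  -- `ι G = ι g₁ · ι g₂`, so `G = g₁ g₂`
  have hGeq : G = g₁ * g₂ := by
    apply iwasawaToPowerSeries_injective p
    rw [map_mul, hιG, hι₁, hι₂, Rat.cast_mul, map_mul]
    ring
  -- `g₂ ≠ 0` (Rohrlich and `ϖ' ≠ 0`)
  have hg₂0 : g₂ ≠ 0 := by
    intro h0
    have hL : padicLFunction M'.f (unitRoot W' p : ℚ_[p]) ≠ 0 :=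
      padicLFunction_unitRoot_ne_zero hord' M'.isNewformOf
    have hC0 : PowerSeries.C ((ϖ' : ℚ) : ℚ_[p]) ≠ 0 := by
      intro hc
      have : ((ϖ' : ℚ) : ℚ_[p]) = 0 := by
        have h := congrArg PowerSeries.constantCoeff hc
        simpa using h
      exact hϖ'0.ne' (by exact_mod_cast this)
    have := hι₂
    rw [h0, map_zero] at this
    exact mul_ne_zero hC0 hL this.symm
  refine ⟨hDt, g₁, ?_, hι₁⟩
  exact eq_span_singleton_of_mul_eq_span_mul hg₁ hg₂ hg₂0 (by rw [← hchar, hG, hGeq])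

/-! ### 7. One-line consequences of Thm. 7.2.3 -/

/-- **Thm. 7.2.3 ⇒ the `K`-level "upper bound" in the shape of Kato–Wuthrich over `K`** (the
divisibility (7.5) of the paper, `ch_{Λ_K⁺}(𝔛_ord(E/K_∞⁺)) ⊇ (𝓛_p^PR(E/K)⁺)`, l. 3344–3347): under the
hypotheses of the fact, `ϖϖ' · L_p(f,α) L_p(g,α') ∈ ι(char_Λ 𝔛_ord(E/K_∞⁺))`.
[cite: CastellaGrossiSkinner2025, Thm. 7.2.3 and display (7.5) = eq:final-cyc-ord-1 (§7.2)] -/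
theorem exists_mem_charIdeal_of_thm723 (h : thm723_charIdeal_eq_padicLFunction_mul)
    (W : WeierstrassCurve ℚ) [W.IsElliptic] [W.IsGloballyMinimal] (p : ℕ) [Fact p.Prime]
    (hp : 2 < p) (hgood : Good W p) (hred : Red W p) (hna : ¬ Anom W p)
    (K : Type) [Field K] [NumberField K] (hK : IsImaginaryQuadratic K)
    (hH : SatisfiesHeegnerHypothesis (W.conductorNorm ℤ) K) (hodd : Odd (discr K))
    (h3 : discr K ≠ -3) (hsplit : ((Ideal.span {(p : ℤ)}).primesOver (𝓞 K)).ncard = 2)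
    (κ : ZpExtension K p) (γ : Field.absoluteGaloisGroup K) (hκ : κ.IsCyclotomic)
    (hγ : κ.IsTopGenerator γ)
    (hγ' : ∃ ζ : ℤ_[p]ˣ, IsOfFinOrder ζ ∧
      ((GaloisRep.cyclotomicCharacter K p γ * ζ : ℤ_[p]ˣ) : ℤ_[p]) = (cyclotomicGenerator p : ℤ_[p]))
    [NeZero (W.conductorNorm ℤ)] (f : CuspForm (Gamma0 (W.conductorNorm ℤ)) 2) (hf : IsNewformOf W f)
    (ϖ : ℚ) (hϖ : (ϖ : ℝ) * W.realPeriodRat = plusPeriod f)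
    (W' : WeierstrassCurve ℚ) [W'.IsElliptic] [W'.IsGloballyMinimal]
    (hW' : ∃ C : VariableChange ℚ, C • W' = W.quadraticTwist (discr K : ℚ))
    [NeZero (W'.conductorNorm ℤ)] (g : CuspForm (Gamma0 (W'.conductorNorm ℤ)) 2)
    (hg : IsNewformOf W' g) (ϖ' : ℚ) (hϖ' : (ϖ' : ℝ) * W'.realPeriodRat = plusPeriod g)
    (D : (W.baseChange K).SelmerDualData κ γ) :
    D.IsTorsion ∧ ∃ G ∈ D.charIdeal, iwasawaToPowerSeries p G =
      PowerSeries.C ((ϖ * ϖ' : ℚ) : ℚ_[p]) *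
        (padicLFunction f (unitRoot W p : ℚ_[p]) * padicLFunction g (unitRoot W' p : ℚ_[p])) := by
  obtain ⟨htors, G, hG, hι⟩ :=
    h W p hp hgood hred hna K hK hH hodd h3 hsplit κ γ hκ hγ hγ' f hf ϖ hϖ W' hW' g hg ϖ' hϖ' D
  exact ⟨htors, G, hG ▸ Ideal.mem_span_singleton_self G, hι⟩

/-- **Theorem A and Theorem 7.2.3 are equivalent modulo Prop. 3.3.1** (with Wuthrich's Thm. 16 and
modularity for the direction 7.2.3 ⇒ A): the `K`-side and `ℚ`-side main conjectures at a good
non-anomalous Eisenstein prime carry the same content in the kernel.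
[cite: CastellaGrossiSkinner2025, §7.2 (Proof of Theorem A) and Prop. 3.3.1] -/
theorem thmA_iff_thm723 (h331 : prop331_nonempty_linearEquiv_prod)
    (hW16 : Wuthrich2014.charIdeal_dvd_padicLFunction)
    (hmod : nonempty_modularParametrizationData) :
    thmA_charIdeal_eq_padicLFunction ↔ thm723_charIdeal_eq_padicLFunction_mul :=
  ⟨fun hA ↦ thm723_of_thmA hA h331, fun h ↦ thmA_of_thm723 h h331 hW16 hmod⟩

end Literature.NumberTheory.EllipticCurves.CastellaGrossiSkinner2025

end
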